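import Summits.AtomisticToContinuum.HydrodynamicLimit.Theorems.InformationPercolationEngineCollisionRateReduction
import HarnessLib

/-!
# `InformationPercolationEngine.CollisionRate` (stmt-AtomisticToContinuum-13481): NECESSITY of the kinetic core T34p —
# under the marginal envelope (A), the crux implies T34p

Helper file NEC (`--supports stmt-AtomisticToContinuum-13481`) of the crux line `Sketch` (lead prover-line-stmt-AtomisticToContinuum-
13481-c8, skeleton `Cruxes/CollisionRate/Lines/Sketch.lean` v26).  The line proves `CollisionRate ⇐ (A) ∧ T34p` (reduction RED′,
sibling helper file); this file proves the CONVERSE direction of its last stub,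

* `stub_evenTubeTimeStatProb_of_evenStatOne` — **`(A) → ESO → T34p`**, where ESO is the constant-mark form of the crux
  (`evenStat σ N (Φ N) τ χ g 1 r → 0` in `LG`-probability, `N → ∞` then `r → 0`; it IS the crux by the tree bridge
  `collisionRate_iff_evenStat_one`), and
* `evenTubeTimeStatProb_of_marginalEnvelope_of_collisionRate` — the by-name corollary **`(A) → CollisionRate → T34p`**.

So together with RED′, `(A) → (CollisionRate ↔ T34p)`: the kinetic core T34p isolated by the line is crux-EQUIVALENT modulo the
a-priori envelope (A) (itself a consequence of the existing item `LanfordEnvelopeR`, stmt-AtomisticToContinuum-13677).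

T34p in words.  For the evolved configurations `Φ_t z` under the local Gibbs law `LG`, `evenTubeTimeStat σ N (Φ N) τ χ g Ξ₁ᴸ r κ`
is the time-integrated BOLTZMANN COLLISION CYLINDER functional at flight-time resolution `κε` (the number of pre-collisional pairs
about to collide within flight time `κε`, weighted by `χ g(σ³ρ_r)` and the speed-truncated unit mark `Ξ₁ᴸ = speedCutoff L ‖w − v‖`,
normalised per particle and per unit flight time) MINUS `σ³ ×` ENSKOG'S PREDICTION for the same quantity computed from the same
configurations' `r`-ball empirical fields (density `ρ_r`, contact value `Y(σ³ρ_r)`, Maxwellian pair flux).  T34p says it is small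
in `LG`-probability, `N → ∞` after `κ → 0`, `L → ∞`, at fixed small `r` — the Boltzmann–Enskog collision-rate hypothesis for the
deterministic hard-sphere flow at fixed reduced diameter `σ`; OPEN at `t > 0`.

Proof (union bound, accuracies `(η/3, δ/3)`).  With `D := evenStat(1)`, `D_L := evenStat(Ξ₁ᴸ)`, `T := evenTubeTimeStat(Ξ₁ᴸ, κ)`,
`T = D − (D − D_L) − (D_L − T)`; `D − D_L` is small by the landed truncation T1 `stub_unitMarkTruncation` (from
`CollisionMomentBound`, itself from (A) through F2 `stub_collisionMarkFluxLG_of_envelope` and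
`Theorems.CollisionMomentBound.collisionMomentBound_of_collisionMarkFlux`), `D_L − T` by the landed cylinder pull-back T2 =
`stub_cylinderPullbackUnit_of_residuals` ∘ (T2a `stub_continuityCorrectionLG`, T2b′ `stub_shortFlightDeficitLG_of_flux` ∘ (F2, F3
`stub_fwdHitFluxLG_of_envelope`), T2c′ `stub_threeBodyCollisionSumLG_of_envelope`) — all from (A) — and `D` by ESO.  Thresholds
`η₀ := min`, `σ₀ := min`, `r₀ := min`, `L₀ := max L₀(T1) 1`, `κ₀ := κ₀(T2)`, `N₀ := max`.  No new definitions; the hypotheses are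
stated verbatim as in the skeleton.  Not here: any claim on (A), ESO or T34p themselves.

References: H. van Beijeren, M. H. Ernst, Physica 68 (1973) 437; P. Résibois, J. Stat. Phys. 19 (1978) 593; H. Spohn, *Large Scale
Dynamics of Interacting Particles* (1991), Part I §2.4, §3; C. Cercignani, R. Illner, M. Pulvirenti, *The Mathematical Theory of
Dilute Gases* (1994), §4.3.
-/

open scoped BigOperators Topology Classical MeasureTheory ProbabilityTheory InnerProductSpace ENNReal
open Filter Set Function MeasureTheory
open Literature.Analysis.FluidPDE Literature.MathematicalPhysics.KineticTheory

namespace Summit.AtomisticToContinuum.HydrodynamicLimit.Theorems.CollisionRate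

open Summit.AtomisticToContinuum.HydrodynamicLimit.Theses.InformationPercolationEngine

noncomputable section

/-- **NEC: `(A) → ESO → T34p` — the kinetic core is necessary.**  Under the marginal envelope (A) of the evolved local Gibbs law,
the constant-mark form ESO of the crux (`evenStat σ N (Φ N) τ χ g 1 r` small in `LG`-probability, `N → ∞` then `r → 0`) implies
T34p: the time-integrated Boltzmann collision cylinder at `Ξ₁ᴸ` and flight-time resolution `κε` minus `σ³ ×` Enskog's prediction,
`evenTubeTimeStat σ N (Φ N) τ χ g Ξ₁ᴸ r κ`, is small in `LG`-probability (`N → ∞` after `κ → 0`, `L ≥ L₀`, small `r`).  Union bound on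
`T = D − (D − D_L) − (D_L − T)` with the landed links T1 `stub_unitMarkTruncation` and T2 `stub_cylinderPullbackUnit_of_residuals`
(fed by T2a, T2b′, T2c′, F2, F3 and `CollisionMomentBound`, all from (A)), accuracies `(η/3, δ/3)`.  Name and header are those of the
registered stub NEC of the skeleton v26. [folklore] -/
theorem stub_evenTubeTimeStatProb_of_evenStatOne :
    (∀ (a₀ θ₀ : T3 → ℝ) (u₀ : T3 → V3), Continuous a₀ → Continuous θ₀ → Continuous u₀ →
      (∀ x, 0 < a₀ x) → (∀ x, 0 < θ₀ x) → ∃ σ₀ : ℝ, 0 < σ₀ ∧ ∀ σ : ℝ, 0 < σ → σ < σ₀ →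
      ∀ Φ : (N : ℕ) → HardSphereFlow (Torus.geometry (Fin 3)) (hsDiameter σ N) (N + 1),
      ∀ τ : ℝ, 0 < τ → ∃ C : ℝ, 0 ≤ C ∧ ∃ u : V3, ∃ θ : ℝ, 0 < θ ∧ ∃ N₀ : ℕ, ∀ N : ℕ, N₀ ≤ N →
      ∀ t ∈ Set.Icc (0 : ℝ) τ,
        (∀ i j : Fin (N + 1), i ≠ j → ∀ f : (T3 × V3) × (T3 × V3) → ℝ≥0∞, Measurable f →
          ∫⁻ z, f ((Φ N).flow t z i, (Φ N).flow t z j) ∂(localGibbsLaw σ a₀ u₀ θ₀ N (Φ N)) ≤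
            ENNReal.ofReal C * ∫⁻ q, f q ∂(((volume : Measure T3).prod (gaussMeasure u θ)).prod
              ((volume : Measure T3).prod (gaussMeasure u θ)))) ∧
        (∀ i j k : Fin (N + 1), i ≠ j → i ≠ k → j ≠ k → ∀ f : (T3 × V3) × (T3 × V3) × (T3 × V3) → ℝ≥0∞, Measurable f →
          ∫⁻ z, f ((Φ N).flow t z i, (Φ N).flow t z j, (Φ N).flow t z k) ∂(localGibbsLaw σ a₀ u₀ θ₀ N (Φ N)) ≤
            ENNReal.ofReal C * ∫⁻ q, f q ∂(((volume : Measure T3).prod (gaussMeasure u θ)).prod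
              (((volume : Measure T3).prod (gaussMeasure u θ)).prod ((volume : Measure T3).prod (gaussMeasure u θ)))))) →
    (∃ η₀ : ℝ, 0 < η₀ ∧ ∀ (a₀ θ₀ : T3 → ℝ) (u₀ : T3 → V3), Continuous a₀ → Continuous θ₀ → Continuous u₀ →
      (∀ x, 0 < a₀ x) → (∀ x, 0 < θ₀ x) → ∃ σ₀ : ℝ, 0 < σ₀ ∧ ∀ σ : ℝ, 0 < σ → σ < σ₀ →
      ∀ Φ : (N : ℕ) → HardSphereFlow (Torus.geometry (Fin 3)) (hsDiameter σ N) (N + 1),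
      ∀ τ : ℝ, 0 < τ → ∀ χ : ℝ × T3 → ℝ, Continuous χ → ∀ g : ℝ → ℝ, Continuous g →
      (∀ a, η₀ ≤ a → g a = 0) →
      ∀ η δ : ℝ, 0 < η → 0 < δ → ∃ r₀ : ℝ, 0 < r₀ ∧ ∀ r : ℝ, 0 < r → r < r₀ →
      ∃ N₀ : ℕ, ∀ N : ℕ, N₀ ≤ N →
        localGibbsLaw σ a₀ u₀ θ₀ N (Φ N) {z | η < |evenStat σ N (Φ N) τ χ g (fun _ => 1) r z|}
          ≤ ENNReal.ofReal δ) →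
    ∃ η₀ : ℝ, 0 < η₀ ∧ ∀ (a₀ θ₀ : T3 → ℝ) (u₀ : T3 → V3), Continuous a₀ → Continuous θ₀ → Continuous u₀ →
      (∀ x, 0 < a₀ x) → (∀ x, 0 < θ₀ x) → ∃ σ₀ : ℝ, 0 < σ₀ ∧ ∀ σ : ℝ, 0 < σ → σ < σ₀ →
      ∀ Φ : (N : ℕ) → HardSphereFlow (Torus.geometry (Fin 3)) (hsDiameter σ N) (N + 1),
      ∀ τ : ℝ, 0 < τ → ∀ χ : ℝ × T3 → ℝ, Continuous χ → ∀ g : ℝ → ℝ, Continuous g →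
      (∀ x, η₀ ≤ x → g x = 0) →
      ∀ η δ : ℝ, 0 < η → 0 < δ → ∃ r₀ : ℝ, 0 < r₀ ∧ ∀ r : ℝ, 0 < r → r < r₀ →
      ∃ L₀ : ℝ, ∀ L : ℝ, L₀ ≤ L → ∃ κ₀ : ℝ, 0 < κ₀ ∧ ∀ κ : ℝ, 0 < κ → κ < κ₀ → ∃ N₀ : ℕ, ∀ N : ℕ, N₀ ≤ N →
        localGibbsLaw σ a₀ u₀ θ₀ N (Φ N)
          {z | η < |evenTubeTimeStat σ N (Φ N) τ χ g (fun q : V3 × V3 × V3 => speedCutoff L ‖q.2.2 - q.2.1‖) r κ z|}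
          ≤ ENNReal.ofReal δ := by
  -- adapted from `evenStatOne_of_marginalEnvelope_of_evenTubeStatL1` (the sufficiency composition, same chain of landed links)
  intro hA hC
  -- the landed links of the chain
  have hF2 := stub_collisionMarkFluxLG_of_envelope hA
  have hF3 := stub_fwdHitFluxLG_of_envelope hA
  have hCMB : CollisionMomentBound :=
    Summit.AtomisticToContinuum.HydrodynamicLimit.Theorems.CollisionMomentBound.collisionMomentBound_of_collisionMarkFlux hF2
  have hT2b := stub_shortFlightDeficitLG_of_flux hF2 hF3
  have hT2 := stub_cylinderPullbackUnit_of_residuals (stub_continuityCorrectionLG hCMB hT2b) hT2b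
    (stub_threeBodyCollisionSumLG_of_envelope hA)
  obtain ⟨η₁, hη₁, H1⟩ := stub_unitMarkTruncation hCMB
  obtain ⟨η₂, hη₂, H2⟩ := hT2
  obtain ⟨ηc, hηc, HC⟩ := hC
  refine ⟨min (min η₁ η₂) ηc, lt_min (lt_min hη₁ hη₂) hηc, ?_⟩
  intro a₀ θ₀ u₀ ha hθ hu ha0 hθ0
  obtain ⟨σ₁, hσ₁, H1⟩ := H1 a₀ θ₀ u₀ ha hθ hu ha0 hθ0
  obtain ⟨σ₂, hσ₂, H2⟩ := H2 a₀ θ₀ u₀ ha hθ hu ha0 hθ0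
  obtain ⟨σc, hσc, HC⟩ := HC a₀ θ₀ u₀ ha hθ hu ha0 hθ0
  refine ⟨min (min σ₁ σ₂) σc, lt_min (lt_min hσ₁ hσ₂) hσc, ?_⟩
  intro σ hσ hσlt Φ τ hτ χ hχ g hg hg0 η δ hη hδ
  have hσ1 : σ < σ₁ := lt_of_lt_of_le hσlt ((min_le_left _ _).trans (min_le_left _ _))
  have hσ2 : σ < σ₂ := lt_of_lt_of_le hσlt ((min_le_left _ _).trans (min_le_right _ _))
  have hσc' : σ < σc := lt_of_lt_of_le hσlt (min_le_right _ _)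
  -- the cutoff vanishes above each threshold
  have hg1 : ∀ x, η₁ ≤ x → g x = 0 := fun x h => hg0 x (((min_le_left _ _).trans (min_le_left _ _)).trans h)
  have hg2 : ∀ x, η₂ ≤ x → g x = 0 := fun x h => hg0 x (((min_le_left _ _).trans (min_le_right _ _)).trans h)
  have hgc : ∀ a, ηc ≤ a → g a = 0 := fun a h => hg0 a ((min_le_right _ _).trans h)
  -- accuracies
  have hη3 : 0 < η / 3 := by positivity
  have hδ3 : 0 < δ / 3 := by positivity
  obtain ⟨r₁, hr₁, H1⟩ := H1 σ hσ hσ1 Φ τ hτ χ hχ g hg hg1 (η / 3) (δ / 3) hη3 hδ3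
  obtain ⟨r₂, hr₂, H2⟩ := H2 σ hσ hσ2 Φ τ hτ χ hχ g hg hg2 (η / 3) (δ / 3) hη3 hδ3
  obtain ⟨rc, hrc, HC⟩ := HC σ hσ hσc' Φ τ hτ χ hχ g hg hgc (η / 3) (δ / 3) hη3 hδ3
  refine ⟨min (min r₁ r₂) rc, lt_min (lt_min hr₁ hr₂) hrc, ?_⟩
  intro r hr hrlt
  have hr1 : r < r₁ := lt_of_lt_of_le hrlt ((min_le_left _ _).trans (min_le_left _ _))
  have hr2 : r < r₂ := lt_of_lt_of_le hrlt ((min_le_left _ _).trans (min_le_right _ _))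
  have hrc' : r < rc := lt_of_lt_of_le hrlt (min_le_right _ _)
  -- truncation level (T1) and the crux statistic (ESO) at this `r`
  obtain ⟨L₀, H1⟩ := H1 r hr hr1
  obtain ⟨Nc, HC⟩ := HC r hr hrc'
  refine ⟨max L₀ 1, fun L hL => ?_⟩
  have hL0 : L₀ ≤ L := (le_max_left _ _).trans hL
  have hL1 : (1 : ℝ) ≤ L := (le_max_right _ _).trans hL
  obtain ⟨N₁, H1⟩ := H1 L hL0
  -- flight-time window (T2)
  obtain ⟨κ₂, hκ₂, H2⟩ := H2 r hr hr2 L hL1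
  refine ⟨κ₂, hκ₂, fun κ hκ hκlt => ?_⟩
  obtain ⟨N₂, H2⟩ := H2 κ hκ hκlt
  refine ⟨max N₁ (max N₂ Nc), fun N hN => ?_⟩
  have hN1 : N₁ ≤ N := (le_max_left _ _).trans hN
  have hN2 : N₂ ≤ N := ((le_max_left _ _).trans (le_max_right _ _)).trans hN
  have hNc : Nc ≤ N := ((le_max_right _ _).trans (le_max_right _ _)).trans hN
  have E1 := H1 N hN1
  have E2 := H2 N hN2
  have EC := HC N hNc
  -- the union bound
  set P := localGibbsLaw σ a₀ u₀ θ₀ N (Φ N) with hP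
  set D := fun z => evenStat σ N (Φ N) τ χ g (fun _ => 1) r z with hD
  set DL := fun z => evenStat σ N (Φ N) τ χ g (fun q : V3 × V3 × V3 => speedCutoff L ‖q.2.2 - q.2.1‖) r z with hDL
  set T := fun z => evenTubeTimeStat σ N (Φ N) τ χ g (fun q : V3 × V3 × V3 => speedCutoff L ‖q.2.2 - q.2.1‖) r κ z
    with hT
  have hsub : {z | η < |T z|} ⊆
      ({z | η / 3 < |D z - DL z|} ∪ {z | η / 3 < |DL z - T z|}) ∪ {z | η / 3 < |D z|} := by
    intro z hz
    simp only [Set.mem_setOf_eq, Set.mem_union] at hz ⊢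
    by_contra hcon
    simp only [not_or, not_lt] at hcon
    obtain ⟨⟨h1, h2⟩, h3⟩ := hcon
    have i1 : |DL z| - |D z| ≤ |D z - DL z| := by
      rw [abs_sub_comm (D z) (DL z)]
      exact abs_sub_abs_le_abs_sub (DL z) (D z)
    have i2 : |T z| - |DL z| ≤ |DL z - T z| := by
      rw [abs_sub_comm (DL z) (T z)]
      exact abs_sub_abs_le_abs_sub (T z) (DL z)
    linarith
  calc P {z | η < |T z|}
      ≤ P (({z | η / 3 < |D z - DL z|} ∪ {z | η / 3 < |DL z - T z|}) ∪ {z | η / 3 < |D z|}) :=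
        measure_mono hsub
    _ ≤ P ({z | η / 3 < |D z - DL z|} ∪ {z | η / 3 < |DL z - T z|}) + P {z | η / 3 < |D z|} :=
        measure_union_le _ _
    _ ≤ (P {z | η / 3 < |D z - DL z|} + P {z | η / 3 < |DL z - T z|}) + P {z | η / 3 < |D z|} :=
        add_le_add (measure_union_le _ _) le_rfl
    _ ≤ (ENNReal.ofReal (δ / 3) + ENNReal.ofReal (δ / 3)) + ENNReal.ofReal (δ / 3) :=
        add_le_add (add_le_add E1 E2) EC
    _ = ENNReal.ofReal δ := by
        rw [← ENNReal.ofReal_add hδ3.le hδ3.le, ← ENNReal.ofReal_add (by positivity) hδ3.le]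
        congr 1
        ring

/-- **`(A) → CollisionRate → T34p`, by name.**  Under the marginal envelope (A) of the evolved local Gibbs law, the crux route decl
`InformationPercolationEngine.CollisionRate` (stmt-AtomisticToContinuum-13481, the Enskog collision-frequency law for the
deterministic hard-sphere flow at fixed `σ`) implies the kinetic core T34p (time-integrated Boltzmann collision cylinder at `Ξ₁ᴸ`,
resolution `κε`, minus `σ³ ×` Enskog's prediction from the configurations' own `r`-ball fields, small in `LG`-probability) — through
the bridge `collisionRate_iff_evenStat_one` and `stub_evenTubeTimeStatProb_of_evenStatOne`.  With the sibling reduction RED′ this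
gives `(A) → (CollisionRate ↔ T34p)`. [folklore] -/
theorem evenTubeTimeStatProb_of_marginalEnvelope_of_collisionRate :
    (∀ (a₀ θ₀ : T3 → ℝ) (u₀ : T3 → V3), Continuous a₀ → Continuous θ₀ → Continuous u₀ →
      (∀ x, 0 < a₀ x) → (∀ x, 0 < θ₀ x) → ∃ σ₀ : ℝ, 0 < σ₀ ∧ ∀ σ : ℝ, 0 < σ → σ < σ₀ →
      ∀ Φ : (N : ℕ) → HardSphereFlow (Torus.geometry (Fin 3)) (hsDiameter σ N) (N + 1),
      ∀ τ : ℝ, 0 < τ → ∃ C : ℝ, 0 ≤ C ∧ ∃ u : V3, ∃ θ : ℝ, 0 < θ ∧ ∃ N₀ : ℕ, ∀ N : ℕ, N₀ ≤ N →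
      ∀ t ∈ Set.Icc (0 : ℝ) τ,
        (∀ i j : Fin (N + 1), i ≠ j → ∀ f : (T3 × V3) × (T3 × V3) → ℝ≥0∞, Measurable f →
          ∫⁻ z, f ((Φ N).flow t z i, (Φ N).flow t z j) ∂(localGibbsLaw σ a₀ u₀ θ₀ N (Φ N)) ≤
            ENNReal.ofReal C * ∫⁻ q, f q ∂(((volume : Measure T3).prod (gaussMeasure u θ)).prod
              ((volume : Measure T3).prod (gaussMeasure u θ)))) ∧
        (∀ i j k : Fin (N + 1), i ≠ j → i ≠ k → j ≠ k → ∀ f : (T3 × V3) × (T3 × V3) × (T3 × V3) → ℝ≥0∞, Measurable f →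
          ∫⁻ z, f ((Φ N).flow t z i, (Φ N).flow t z j, (Φ N).flow t z k) ∂(localGibbsLaw σ a₀ u₀ θ₀ N (Φ N)) ≤
            ENNReal.ofReal C * ∫⁻ q, f q ∂(((volume : Measure T3).prod (gaussMeasure u θ)).prod
              (((volume : Measure T3).prod (gaussMeasure u θ)).prod ((volume : Measure T3).prod (gaussMeasure u θ)))))) →
    Summit.AtomisticToContinuum.HydrodynamicLimit.Theses.InformationPercolationEngine.CollisionRate →
    ∃ η₀ : ℝ, 0 < η₀ ∧ ∀ (a₀ θ₀ : T3 → ℝ) (u₀ : T3 → V3), Continuous a₀ → Continuous θ₀ → Continuous u₀ →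
      (∀ x, 0 < a₀ x) → (∀ x, 0 < θ₀ x) → ∃ σ₀ : ℝ, 0 < σ₀ ∧ ∀ σ : ℝ, 0 < σ → σ < σ₀ →
      ∀ Φ : (N : ℕ) → HardSphereFlow (Torus.geometry (Fin 3)) (hsDiameter σ N) (N + 1),
      ∀ τ : ℝ, 0 < τ → ∀ χ : ℝ × T3 → ℝ, Continuous χ → ∀ g : ℝ → ℝ, Continuous g →
      (∀ x, η₀ ≤ x → g x = 0) →
      ∀ η δ : ℝ, 0 < η → 0 < δ → ∃ r₀ : ℝ, 0 < r₀ ∧ ∀ r : ℝ, 0 < r → r < r₀ →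
      ∃ L₀ : ℝ, ∀ L : ℝ, L₀ ≤ L → ∃ κ₀ : ℝ, 0 < κ₀ ∧ ∀ κ : ℝ, 0 < κ → κ < κ₀ → ∃ N₀ : ℕ, ∀ N : ℕ, N₀ ≤ N →
        localGibbsLaw σ a₀ u₀ θ₀ N (Φ N)
          {z | η < |evenTubeTimeStat σ N (Φ N) τ χ g (fun q : V3 × V3 × V3 => speedCutoff L ‖q.2.2 - q.2.1‖) r κ z|}
          ≤ ENNReal.ofReal δ :=
  fun hA h => stub_evenTubeTimeStatProb_of_evenStatOne hA (collisionRate_iff_evenStat_one.1 h)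

end

end Summit.AtomisticToContinuum.HydrodynamicLimit.Theorems.CollisionRate
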